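import Mathlib
import Summits.Ventures.HodgeRepro2.T5WedgeRank

/-!
# T5IdentityPrinciple — the identity-theorem step (i) ⟺ (iv) of H6 (route/T5-N1-hodge-p6.md)

Tier-5 support of seat p6 (Hodge-theoretic side of N1, cell pub-hodge-repro2).

Memo H6 states, for a connected component `S_j` of the compact surface `S` and the two
pulled-back holomorphic 1-forms `u = f_a^* e_{a,σ}`, `v = f_b^* e_{b,σ}`, that the following are
equivalent: (i) `ω_{ab} = u ∧ v ≠ 0` on `S_j`; (ii) the covectors `u_s, v_s` are linearly
independent at SOME point `s`; (iii) the map `F_{ab}` has invertible differential at `s`;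
(iv) (iii) holds on a DENSE OPEN subset of `S_j`.  `T5WedgeRank` kernel-checks (ii) ⟺ (iii)
pointwise (`wedge10_ne_zero_iff`).  This file kernel-checks the remaining step, the *identity
principle*: the coefficient `g = wedge10 (u x) (v x)` of `ω_{ab}` in the local coordinates
`dz_a ∧ dz_b` is an analytic function on a chart, and an analytic function on a connected open
set which is non-zero at ONE point is non-zero on a dense open subset (Mathlib
`AnalyticOnNhd.eqOn_zero_of_preconnected_of_eventuallyEq_zero`).  Everything is local (one
chart `U ⊆ E`, `E` a complex normed space); the global statement on the manifold `S_j` is the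
conjunction over a connected chain of charts and is not formalised here.

Nothing here is automorphic; the file does not touch the statement (N) itself.
-/

namespace Summit.Ventures.HodgeRepro2.T5IdentityPrinciple

open Set Filter Topology

section Locus

variable {E F : Type*} [Zero F]

/-- The non-vanishing locus of `f` inside `U`: the points of `U` where `f` is not zero. -/
def neLocus (f : E → F) (U : Set E) : Set E := {x | x ∈ U ∧ f x ≠ 0}

/-- Membership in the non-vanishing locus, unfolded. -/
theorem mem_neLocus {f : E → F} {U : Set E} {x : E} : x ∈ neLocus f U ↔ x ∈ U ∧ f x ≠ 0 :=
  Iff.rfl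

/-- The non-vanishing locus is contained in `U`. -/
theorem neLocus_subset (f : E → F) (U : Set E) : neLocus f U ⊆ U := fun _ hx => hx.1

/-- On the whole space the non-vanishing locus is just `{x | f x ≠ 0}`. -/
theorem neLocus_univ (f : E → F) : neLocus f univ = {x | f x ≠ 0} := by
  ext x
  simp [neLocus]

end Locus

section General

variable {𝕜 : Type*} [NontriviallyNormedField 𝕜]
  {E : Type*} [NormedAddCommGroup E] [NormedSpace 𝕜 E]
  {F : Type*} [NormedAddCommGroup F] [NormedSpace 𝕜 F]

/-- The non-vanishing locus of a function analytic on an open set `U` is open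
(analytic ⇒ continuous, and `f x ≠ 0` is an open condition). This is the "open" half of
H6 (iv). -/
theorem isOpen_neLocus {f : E → F} {U : Set E} (hf : AnalyticOnNhd 𝕜 f U) (hU : IsOpen U) :
    IsOpen (neLocus f U) := by
  rw [isOpen_iff_mem_nhds]
  intro x hx
  rw [mem_neLocus] at hx
  have h1 : ∀ᶠ y in 𝓝 x, f y ≠ 0 := (hf x hx.1).continuousAt.eventually_ne hx.2
  filter_upwards [h1, hU.mem_nhds hx.1] with y hy hyU
  exact mem_neLocus.mpr ⟨hyU, hy⟩

/-- The identity principle in the form used by H6: if a point `z` of the connected open set `U`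
is NOT in the closure of the non-vanishing locus, then `f` vanishes on a neighbourhood of `z`,
hence (Mathlib's `AnalyticOnNhd.eqOn_zero_of_preconnected_of_eventuallyEq_zero`) on all of `U`. -/
theorem eqOn_zero_of_notMem_closure {f : E → F} {U : Set E} (hf : AnalyticOnNhd 𝕜 f U)
    (hU : IsPreconnected U) (hUo : IsOpen U) {z : E} (hz : z ∈ U)
    (h : z ∉ closure (neLocus f U)) : EqOn f 0 U := by
  have hev : f =ᶠ[𝓝 z] 0 := by
    simp only [mem_closure_iff_nhds, not_forall] at h
    obtain ⟨t, ht, hts⟩ := h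
    filter_upwards [ht, hUo.mem_nhds hz] with y hyt hyU
    by_contra hy
    exact hts ⟨y, hyt, mem_neLocus.mpr ⟨hyU, hy⟩⟩
  exact hf.eqOn_zero_of_preconnected_of_eventuallyEq_zero hU hz hev

/-- H6 (i) ⟹ (iv), the "dense" half: an analytic function on a connected open set `U` which is
non-zero at ONE point of `U` is non-zero on a subset of `U` whose closure contains `U`. -/
theorem subset_closure_neLocus_of_exists {f : E → F} {U : Set E} (hf : AnalyticOnNhd 𝕜 f U)
    (hU : IsPreconnected U) (hUo : IsOpen U) (h : ∃ x ∈ U, f x ≠ 0) :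
    U ⊆ closure (neLocus f U) := by
  intro z hz
  by_contra hzc
  obtain ⟨x, hxU, hx⟩ := h
  exact hx (eqOn_zero_of_notMem_closure hf hU hUo hz hzc hxU)

/-- H6 (i) ⟺ (iv) on a chart: for `f` analytic on a non-empty connected open set `U`,
`f` is non-zero somewhere on `U` iff its non-vanishing locus is dense in `U`
(the locus is open by `isOpen_neLocus`). -/
theorem exists_ne_zero_iff_subset_closure {f : E → F} {U : Set E} (hf : AnalyticOnNhd 𝕜 f U)
    (hU : IsPreconnected U) (hUo : IsOpen U) (hne : U.Nonempty) :
    (∃ x ∈ U, f x ≠ 0) ↔ U ⊆ closure (neLocus f U) := by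
  constructor
  · exact subset_closure_neLocus_of_exists hf hU hUo
  · intro hsub
    obtain ⟨z, hz⟩ := hne
    obtain ⟨y, hy⟩ := closure_nonempty_iff.mp ⟨z, hsub hz⟩
    exact ⟨y, (mem_neLocus.mp hy).1, (mem_neLocus.mp hy).2⟩

/-- The contrapositive form: if the non-vanishing locus is not dense in `U` then `f = 0` on `U`. -/
theorem eqOn_zero_of_not_subset_closure {f : E → F} {U : Set E} (hf : AnalyticOnNhd 𝕜 f U)
    (hU : IsPreconnected U) (hUo : IsOpen U) (h : ¬ U ⊆ closure (neLocus f U)) :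
    EqOn f 0 U := by
  intro x hx
  by_contra hfx
  exact h (subset_closure_neLocus_of_exists hf hU hUo ⟨x, hx, hfx⟩)

/-- The whole-space form: on a connected normed space, an analytic function is non-zero
somewhere iff `{x | f x ≠ 0}` is dense. -/
theorem exists_ne_zero_iff_dense [PreconnectedSpace E] [Nonempty E] {f : E → F}
    (hf : AnalyticOnNhd 𝕜 f univ) : (∃ x, f x ≠ 0) ↔ Dense {x | f x ≠ 0} := by
  have h := exists_ne_zero_iff_subset_closure hf isPreconnected_univ isOpen_univ univ_nonempty
  rw [neLocus_univ] at h
  rw [dense_iff_closure_eq, ← univ_subset_iff]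
  simpa only [mem_univ, true_and] using h

end General

section H6Def

variable {E : Type*}

/-- The coefficient of `ω_{ab} = u ∧ v` in the coordinates `dz_a ∧ dz_b`, as a function of the
point `x` of the chart: `wedgeCoeff u v x = wedge10 (u x) (v x) = u x 0 * v x 1 - u x 1 * v x 0`
(`T5WedgeRank.wedge10`). -/
def wedgeCoeff (u v : E → (Fin 2 → ℂ)) (x : E) : ℂ := T5WedgeRank.wedge10 (u x) (v x)

/-- `wedgeCoeff` unfolded. -/
theorem wedgeCoeff_apply (u v : E → (Fin 2 → ℂ)) (x : E) :
    wedgeCoeff u v x = u x 0 * v x 1 - u x 1 * v x 0 := rfl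

/-- The pointwise statement of H6 (ii) ⟺ (iii), restated for `wedgeCoeff`
(`T5WedgeRank.wedge10_ne_zero_iff`). -/
theorem wedgeCoeff_ne_zero_iff (u v : E → (Fin 2 → ℂ)) (x : E) :
    wedgeCoeff u v x ≠ 0 ↔ LinearIndependent ℂ ![u x, v x] :=
  T5WedgeRank.wedge10_ne_zero_iff (u x) (v x)

/-- The locus of H6 (iii): the points of `U` where the two covectors are linearly independent
equals the non-vanishing locus of `wedgeCoeff`. -/
theorem neLocus_wedgeCoeff (u v : E → (Fin 2 → ℂ)) (U : Set E) :
    neLocus (wedgeCoeff u v) U = {x | x ∈ U ∧ LinearIndependent ℂ ![u x, v x]} := by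
  ext x
  simp only [mem_neLocus, mem_setOf_eq, wedgeCoeff_ne_zero_iff]

end H6Def

section H6

variable {E : Type*} [NormedAddCommGroup E] [NormedSpace ℂ E]

/-- A coordinate of an analytic `(Fin 2 → ℂ)`-valued map is analytic. -/
theorem analyticAt_coord {u : E → (Fin 2 → ℂ)} {x : E} (hu : AnalyticAt ℂ u x) (i : Fin 2) :
    AnalyticAt ℂ (fun y => u y i) x :=
  ((ContinuousLinearMap.proj (R := ℂ) (φ := fun _ : Fin 2 => ℂ) i).analyticAt (u x)).comp hu

/-- The coefficient of `u ∧ v` is analytic where `u` and `v` are (products and differences of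
analytic functions). -/
theorem analyticAt_wedgeCoeff {u v : E → (Fin 2 → ℂ)} {x : E} (hu : AnalyticAt ℂ u x)
    (hv : AnalyticAt ℂ v x) : AnalyticAt ℂ (wedgeCoeff u v) x := by
  have h : wedgeCoeff u v = fun y => u y 0 * v y 1 - u y 1 * v y 0 := funext fun y => rfl
  rw [h]
  exact ((analyticAt_coord hu 0).mul (analyticAt_coord hv 1)).sub
    ((analyticAt_coord hu 1).mul (analyticAt_coord hv 0))

/-- The same on a set. -/
theorem analyticOnNhd_wedgeCoeff {u v : E → (Fin 2 → ℂ)} {U : Set E} (hu : AnalyticOnNhd ℂ u U)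
    (hv : AnalyticOnNhd ℂ v U) : AnalyticOnNhd ℂ (wedgeCoeff u v) U :=
  fun x hx => analyticAt_wedgeCoeff (hu x hx) (hv x hx)

/-- H6 (ii) ⟹ (iv) on a chart, the open half: the independence locus is open. -/
theorem isOpen_linearIndependent_locus {u v : E → (Fin 2 → ℂ)} {U : Set E}
    (hu : AnalyticOnNhd ℂ u U) (hv : AnalyticOnNhd ℂ v U) (hUo : IsOpen U) :
    IsOpen {x | x ∈ U ∧ LinearIndependent ℂ ![u x, v x]} := by
  rw [← neLocus_wedgeCoeff]
  exact isOpen_neLocus (analyticOnNhd_wedgeCoeff hu hv) hUo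

/-- **H6 (i)/(ii) ⟺ (iv) on a chart.** For `u, v` analytic on a non-empty connected open
`U`: the covectors `u x, v x` are linearly independent at SOME point of `U` iff they are
linearly independent on a subset of `U` dense in `U` (open by
`isOpen_linearIndependent_locus`). By `wedgeCoeff_ne_zero_iff` the left side is
«`ω_{ab} ≠ 0` somewhere on the chart», i.e. H6 (i) for the chart. -/
theorem exists_linearIndependent_iff_subset_closure {u v : E → (Fin 2 → ℂ)} {U : Set E}
    (hu : AnalyticOnNhd ℂ u U) (hv : AnalyticOnNhd ℂ v U) (hU : IsPreconnected U)
    (hUo : IsOpen U) (hne : U.Nonempty) :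
    (∃ x ∈ U, LinearIndependent ℂ ![u x, v x]) ↔
      U ⊆ closure {x | x ∈ U ∧ LinearIndependent ℂ ![u x, v x]} := by
  rw [← neLocus_wedgeCoeff]
  have h := exists_ne_zero_iff_subset_closure (analyticOnNhd_wedgeCoeff hu hv) hU hUo hne
  simp only [wedgeCoeff_ne_zero_iff] at h
  exact h

/-- H6's first consequence: if the pair is dependent on a non-empty open subset of the
connected chart (e.g. `f_a` constant there, so `u = 0` there), then `ω_{ab} = 0` on the whole
chart. -/
theorem wedgeCoeff_eqOn_zero_of_eqOn_zero_open {u v : E → (Fin 2 → ℂ)} {U V : Set E}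
    (hu : AnalyticOnNhd ℂ u U) (hv : AnalyticOnNhd ℂ v U) (hU : IsPreconnected U)
    (hVo : IsOpen V) (hVU : V ⊆ U) (hVne : V.Nonempty)
    (hdep : ∀ x ∈ V, ¬ LinearIndependent ℂ ![u x, v x]) :
    EqOn (wedgeCoeff u v) 0 U := by
  obtain ⟨z, hz⟩ := hVne
  have hev : wedgeCoeff u v =ᶠ[𝓝 z] 0 := by
    filter_upwards [hVo.mem_nhds hz] with y hy
    have := hdep y hy
    rw [← wedgeCoeff_ne_zero_iff, not_not] at this
    exact this
  exact (analyticOnNhd_wedgeCoeff hu hv).eqOn_zero_of_preconnected_of_eventuallyEq_zero hU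
    (hVU hz) hev

end H6

end Summit.Ventures.HodgeRepro2.T5IdentityPrinciple
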